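import Summits.BirchSwinnertonDyer.BirchSwinnertonDyer.Theses.VerticalContact
import Literature.NumberTheory.EllipticCurves.BSDSelmerParityDokchitserProofs
import Literature.NumberTheory.EllipticCurves.LeadingTerm
import HarnessLib

/-!
# BirchSwinnertonDyer / VerticalContact — crux `PGSelmerBSD` (stmt-BirchSwinnertonDyer-17810),
# line `Sketch`, stub `stub_rankLeOne`: conditional closure

Registered stub 1 of `Cruxes/PGSelmerBSD/Lines/Sketch.lean` (the cell `r_an ≤ 1` of the sorry-free
composition `PGSelmerBSD_of`):
`∀ W [W.IsElliptic] [W.IsGloballyMinimal], r_an(W) ≤ 1 → ∃ p prime, corank_{ℤ_p} Sel_{p^∞}(W/ℚ) = r_an(W)`.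
KNOWN IN PRINT (Gross–Zagier 1986, Thm. I.6.3 + Kolyvagin 1990, with modularity; printed as
Darmon 2004, Thm. 3.22: `ord_{s=1} L(E,s) ≤ 1 ⇒ rank E(ℚ) = ord_{s=1} L(E,s)` and `Ш(E/ℚ)` finite),
NOT provable in the tree today (2026-08-17): it rests on the undischarged named fact bsd.S17
`Literature.NumberTheory.EllipticCurves.rank_eq_analyticRank_of_analyticRank_le_one` (no `_holds`;
every in-tree reduction — `…_of`, `…_of_modularity`, `…_of_modularity''`, `…_of_heegnerPoint`, … —
takes modularity, the Gross–Zagier formula, Kolyvagin's Theorem A and non-vanishing quadratic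
twists as hypotheses, none discharged; cf. `Theorems/TangentConeRankLeOne.lean`).

`stub_rankLeOne_of_facts` records, machine-checked, that the stub FOLLOWS from bsd.S17 alone, at
the prime `2` (indeed at any prime): `corank_{ℤ_p} Sel_{p^∞} = rank + corank Ш[p^∞]` (Greenberg's
identity, PROVED: `selmerCorank_eq_mordellWeilRank_add_holds`) `= r_an + 0`
(`shaCorank_eq_zero_of_finite`), packaged in the tree as the proved
`selmerCorank_eq_analyticRank_of_analyticRank_le_one`. Nothing here is unconditional; no
definition, no new named fact; the instance `[W.IsGloballyMinimal]` of the registered signature is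
not used (all quantities are model-independent).
-/

-- D-0017: single-problem summit, so `Summit.BirchSwinnertonDyer.BirchSwinnertonDyer.…` repeats a
-- namespace BY DESIGN.
set_option linter.dupNamespace false

namespace Summit.BirchSwinnertonDyer.BirchSwinnertonDyer.Theorems

open Literature.NumberTheory.EllipticCurves

/-- **Stub `stub_rankLeOne` of line `Sketch` (crux `PGSelmerBSD`) from bsd.S17
(Gross–Zagier–Kolyvagin, Darmon 2004 Thm. 3.22).** If every elliptic `E/ℚ` with
`ord_{s=1} L(E,s) ≤ 1` has `rank_ℤ E(ℚ) = ord_{s=1} L(E,s)` and finite `Ш(E/ℚ)` (the named fact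
`rank_eq_analyticRank_of_analyticRank_le_one`, hypothesis `hGZK`, UNPROVED in the tree), then for
every elliptic, globally minimal `W/ℚ` with `r_an(W) ≤ 1` there is a prime `p` (namely `p = 2`;
any prime works) with `corank_{ℤ_p} Sel_{p^∞}(W/ℚ) = r_an(W)`: the proved
`selmerCorank_eq_analyticRank_of_analyticRank_le_one` (Greenberg's corank identity
`corank Sel_{p^∞} = rank + corank Ш[p^∞]` with `corank Ш[p^∞] = 0` for finite `Ш`). Colon form:
antecedent = the named fact, consequent = the registered stub signature verbatim. CONDITIONAL on
the antecedent. [cite: Darmon2004, Thm. 3.22 (= Thm. 1.14)] -/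
theorem stub_rankLeOne_of_facts :
    Literature.NumberTheory.EllipticCurves.rank_eq_analyticRank_of_analyticRank_le_one →
      ∀ (W : WeierstrassCurve ℚ) [W.IsElliptic] [W.IsGloballyMinimal],
        W.analyticRank ≤ 1 → ∃ (p : ℕ) (_ : Fact p.Prime), W.selmerCorank p = W.analyticRank :=
  fun hGZK W _ _ h =>
    ⟨2, ⟨Nat.prime_two⟩, selmerCorank_eq_analyticRank_of_analyticRank_le_one hGZK W 2 h⟩

end Summit.BirchSwinnertonDyer.BirchSwinnertonDyer.Theorems
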